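import Literature.IUT.LogVolume.LocalFieldVolume
import HarnessLib

/-!
# Volumes of the unit group `O_k^×` and of the principal units `1 + m_k^n`

The first step of the proof of [IUTchIV] Prop. 1.4 (ii) (kurims p. 14): "it follows immediately from the
basic properties of the log-volume [cf. [AbsTopIII], Proposition 5.7, (i), (a)] that
`e_i·f_i·μ^log(R_i^×) = log(1 − p^{−f_i})`" — i.e. the (un-normalised) volume of the unit group of a
nonarchimedean local field with residue cardinality `q = p^f` is `μ_k(O_k^×) = 1 − q⁻¹` — together with
the volumes of the principal units `U^{(n)} = 1 + m_k^n` (`μ_k(1 + m_k^n) = q^{−n}`, translation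
invariance), over `LocalFieldVolume.lean` (norm presentation of the local field `K`).

* `unitSphere_eq_diff`: `O_k^× = {‖x‖ = 1} = O_k ∖ m_k` with `m_k = closedBall 0 ‖ϖ‖ = ball 0 1`;
* `localVolume_unitSphere` (`= 1 − q⁻¹`), `localVolume_real_unitSphere`, `localLogVolume_unitSphere`
  (`= log(1 − q⁻¹)`), and the printed form `localLogVolume_unitSphere_of_residueCard_eq_pow`
  (`= log(1 − p^{−f})`) / `mul_normalizedLocalLogVolume_unitSphere` (`e·f·μ^log(R^×) = log(1 − p^{−f})`
  for the weight-`ef` normalised log-volume);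
* `localVolume_principalUnits` (`μ_k(1 + m_k^n) = q^{−n}`), `localLogVolume_principalUnits`.
[cite: Mochizuki2012, IUTchIV Prop. 1.4 (ii) proof p. 14] [cite: MochizukiAbsTopIII2015, Prop. 5.7 (i)(a) p. 137]
Deliberately NOT here: the `p`-adic logarithm and `μ^log(log_p(R^×))` itself (Prop. 1.4 (ii); needs the
kernel/torsion facts of the logarithm files), any judgement on [IUTchIII] Cor. 3.12.
-/

noncomputable section

open MeasureTheory MeasureTheory.Measure Set Metric TopologicalSpace
open scoped ENNReal NNReal Pointwise NormedField
open Literature.NumberTheory.GaloisRepresentations.Ultrametric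

namespace Literature.IUT.LogVolume

variable (K : Type*) [NontriviallyNormedField K] [IsUltrametricDist K] [ProperSpace K]
  [MeasurableSpace K] [BorelSpace K]

omit [IsUltrametricDist K] [ProperSpace K] [MeasurableSpace K] [BorelSpace K] in
/-- `O_k^× = O_k ∖ m_k`: the unit sphere is the closed unit ball minus the maximal ideal
`m_k = closedBall 0 ‖ϖ‖` (`ϖ` a uniformizer). [cite: MochizukiAbsTopIII2015, Prop. 5.7 (i)(a) p. 137] -/
theorem unitSphere_eq_diff {ϖ : Kˣ} (hϖ : IsUniformizer ϖ) :
    sphere (0 : K) 1 = closedBall (0 : K) 1 \ closedBall (0 : K) ‖(ϖ : K)‖ := by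
  rw [hϖ.closedBall_norm_eq_ball_one, closedBall_sdiff_ball]

/-- **`μ_k(O_k^×) = 1 − q⁻¹`**. [cite: MochizukiAbsTopIII2015, Prop. 5.7 (i)(a) p. 137] -/
theorem localVolume_unitSphere :
    localVolume K (sphere (0 : K) 1) = 1 - ((residueCard K : ℝ≥0∞))⁻¹ := by
  obtain ⟨ϖ, hϖ⟩ := exists_isUniformizer (F := K)
  rw [unitSphere_eq_diff K hϖ, measure_sdiff (closedBall_subset_closedBall hϖ.1.le)
    measurableSet_closedBall.nullMeasurableSet (measure_ne_top_of_subset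
      (closedBall_subset_closedBall hϖ.1.le) (by simp)), localVolume_closedBall_one]
  have := localVolume_closedBall_zpow K hϖ 1
  rw [zpow_one, zpow_one] at this
  have hq0 : (residueCard K : ℝ≥0) ≠ 0 := by
    have := two_le_residueCard K
    exact_mod_cast (by omega : residueCard K ≠ 0)
  rw [this, ENNReal.coe_inv hq0, ENNReal.coe_natCast]

/-- `μ_k(O_k^×) = 1 − q⁻¹` in `ℝ`. [cite: MochizukiAbsTopIII2015, Prop. 5.7 (i)(a) p. 137] -/
theorem localVolume_real_unitSphere :
    (localVolume K (sphere (0 : K) 1)).toReal = 1 - ((residueCard K : ℝ))⁻¹ := by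
  rw [localVolume_unitSphere, ENNReal.toReal_sub_of_le, ENNReal.toReal_one, ENNReal.toReal_inv,
    ENNReal.toReal_natCast]
  · rw [ENNReal.inv_le_one]
    have := two_le_residueCard K
    exact_mod_cast (by omega : 1 ≤ residueCard K)
  · exact ENNReal.one_ne_top

omit [MeasurableSpace K] [BorelSpace K] in
/-- `0 < 1 − q⁻¹`. [cite: MochizukiAbsTopIII2015, Prop. 5.7 (i)(a) p. 137] -/
theorem one_sub_inv_residueCard_pos : (0 : ℝ) < 1 - ((residueCard K : ℝ))⁻¹ := by
  have h := one_lt_residueCard_real K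
  have : ((residueCard K : ℝ))⁻¹ < 1 := inv_lt_one_of_one_lt₀ h
  linarith

/-- **`μ^log_k(O_k^×) = log(1 − q⁻¹)`**. [cite: MochizukiAbsTopIII2015, Prop. 5.7 (i)(a) p. 137] -/
theorem localLogVolume_unitSphere :
    localLogVolume K (sphere (0 : K) 1) = Real.log (1 - ((residueCard K : ℝ))⁻¹) := by
  rw [localLogVolume_eq_log, localVolume_real_unitSphere]

/-- **As used in [IUTchIV] Prop. 1.4 (ii)**: with `q = p^f`, `μ^log_k(O_k^×) = log(1 − p^{−f})`
("`e_i·f_i·μ^log(R_i^×) = log(1 − p^{−f_i})`", the left side being the un-normalised log-volume).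
[cite: Mochizuki2012, IUTchIV Prop. 1.4 (ii) proof p. 14] -/
theorem localLogVolume_unitSphere_of_residueCard_eq_pow {p f : ℕ} (hq : residueCard K = p ^ f) :
    localLogVolume K (sphere (0 : K) 1) = Real.log (1 - (p : ℝ) ^ (-(f : ℤ))) := by
  rw [localLogVolume_unitSphere, hq, zpow_neg, zpow_natCast]
  push_cast
  rfl

/-- The same for the weight-`d` normalised log-volume of [IUTchIV] Prop. 1.4 (i), `d = e·f`:
`(e·f)·μ^log(R^×) = log(1 − p^{−f})`. [cite: Mochizuki2012, IUTchIV Prop. 1.4 (ii) proof p. 14] -/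
theorem mul_normalizedLocalLogVolume_unitSphere {p e f : ℕ} (hq : residueCard K = p ^ f)
    (hd0 : e * f ≠ 0) :
    ((e * f : ℕ) : ℝ) * normalizedLocalLogVolume K (e * f) (sphere (0 : K) 1) =
      Real.log (1 - (p : ℝ) ^ (-(f : ℤ))) := by
  rw [normalizedLocalLogVolume_eq_div, localLogVolume_unitSphere_of_residueCard_eq_pow K hq]
  have : ((e * f : ℕ) : ℝ) ≠ 0 := by exact_mod_cast hd0
  field_simp

omit [MeasurableSpace K] [BorelSpace K] in
/-- The unit sphere `O_k^×` is compact and open (an element of `M(k)`).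
[cite: MochizukiAbsTopIII2015, Prop. 5.7 (i)(a) p. 137] -/
theorem isCompact_isOpen_unitSphere : IsCompact (sphere (0 : K) 1) ∧ IsOpen (sphere (0 : K) 1) := by
  obtain ⟨ϖ, hϖ⟩ := exists_isUniformizer (F := K)
  refine ⟨isCompact_sphere 0 1, ?_⟩
  rw [unitSphere_eq_diff K hϖ]
  exact (IsUltrametricDist.isOpen_closedBall _ one_ne_zero).sdiff isClosed_closedBall

/-! ### Principal units -/

/-- The principal units of level `n`: `U^{(n)} = 1 + m_k^n = 1 + closedBall 0 ‖ϖ‖^n`.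
[cite: Mochizuki2012, IUTchIV Prop. 1.2 (i) p. 10] -/
def principalUnits (ϖ : Kˣ) (n : ℤ) : Set K := (1 : K) +ᵥ closedBall (0 : K) (‖(ϖ : K)‖ ^ n)

omit [IsUltrametricDist K] [ProperSpace K] [MeasurableSpace K] [BorelSpace K] in
/-- Membership: `y ∈ 1 + m_k^n ↔ ‖y − 1‖ ≤ ‖ϖ‖^n`. [cite: Mochizuki2012, IUTchIV Prop. 1.2 (i) p. 10] -/
theorem mem_principalUnits {ϖ : Kˣ} {n : ℤ} {y : K} :
    y ∈ principalUnits K ϖ n ↔ ‖y - 1‖ ≤ ‖(ϖ : K)‖ ^ n := by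
  rw [principalUnits, Set.mem_vadd_set]
  constructor
  · rintro ⟨z, hz, rfl⟩
    simpa [vadd_eq_add] using hz
  · intro h
    exact ⟨y - 1, by simpa using h, by simp [vadd_eq_add]⟩

/-- **`μ_k(1 + m_k^n) = q^{−n}`** (translation invariance and `μ_k(m_k^n) = q^{−n}`).
[cite: MochizukiAbsTopIII2015, Prop. 5.7 (i)(a) p. 137] -/
theorem localVolume_real_principalUnits {ϖ : Kˣ} (hϖ : IsUniformizer ϖ) (n : ℤ) :
    (localVolume K (principalUnits K ϖ n)).toReal = (residueCard K : ℝ) ^ (-n) := by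
  rw [principalUnits, localVolume_vadd, localVolume_real_closedBall_zpow K hϖ n]

/-- `μ^log_k(1 + m_k^n) = −n·log q`. [cite: MochizukiAbsTopIII2015, Prop. 5.7 (i)(a) p. 137] -/
theorem localLogVolume_principalUnits {ϖ : Kˣ} (hϖ : IsUniformizer ϖ) (n : ℤ) :
    localLogVolume K (principalUnits K ϖ n) = -(n * Real.log (residueCard K)) := by
  rw [principalUnits, localLogVolume_vadd, localLogVolume_closedBall_zpow K hϖ n]

end Literature.IUT.LogVolume
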